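import Summits.MatrixMultiplication.MatrixMultiplication.Theorems.SoloInformedDegenerationCertificate
import Summits.MatrixMultiplication.MatrixMultiplication.Theorems.SoloInformedTTwoSquareBini
import Summits.MatrixMultiplication.MatrixMultiplication.Theorems.SoloInformedAsymptoticRankPower
import Literature.Computability.AlgebraicComplexity.BorderRankCWProofs
import Literature.Computability.AlgebraicComplexity.AlmanLi2026SmallCW
import Literature.Computability.AlgebraicComplexity.FlatteningRank
import Literature.Computability.AlgebraicComplexity.RelativeExponentTriangle
import HarnessLib

/-!
# The door tensor `T_{cw,2}` degenerates to the algebra `U₂` of upper triangular `2 × 2` matrices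

Solo-informed seat (gen 25), paper §2n (the degeneration neighbourhood of the door tensor).
Everything here is PROVED.

Door D1 of the programme is `R̃(T_{cw,2}) = 3 ⇒ ω = 2` (Coppersmith–Winograd 1990 / BCS (15.44),
in tree as `omega_le_two_of_cw_two`, `matrixMultiplication_of_asymptoricRank_cwTensor_two_le_three`).
Over `ℂ`, `T_{cw,2} ≅ ∑_{σ ∈ 𝔖₃} e_{σ(0)} ⊗ e_{σ(1)} ⊗ e_{σ(2)} =: P` (entries `|ε_{ijk}|`; CGLV 2022
§3.2, `cglv_exists_basis_cwTensor_two`).  `P` is polystable with a `23`-dimensional `GL₃^{×3}`-orbit,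
so its proper degenerations lie in the null cone.  The main theorem of this file DECIDES one
membership question in that boundary, by an explicit kernel-checked certificate:

* `sThree_tTwo_check` / `sThree_polyDegeneratesTo_tTwo` — **`P ⊵ T₂`**, where
  `T₂ = e₀e₀e₀ + e₀e₁e₁ + e₁e₂e₁ + e₂e₂e₂` (`tTwo`, gen 24) is the structure tensor of the
  incidence algebra of the `2`-chain, i.e. of the algebra `U₂ ⊂ Mat₂` of upper triangular matrices
  (`R̲(T₂) = 4`, `algBorderRank_tTwo`; a `19`-dimensional nilpotent orbit).  The degeneration has
  order `4` and integer data with multiplier `D = 2`: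
  `(A(ε) ⊗ B(ε) ⊗ C(ε))·P = 2ε⁴·T₂ − 2ε⁸ e₁e₀e₀ − 2ε⁷ e₁e₀e₂ + 2ε⁹ e₂e₁e₀ + 2ε⁸ e₂e₁e₂`, with the
  toric weights `(0,4,3 | 2,4,0 | 2,0,1)` on the rows of the constant matrices
  `A₀ = ((1,1,0),(-2,0,0),(0,0,1))`, `B₀ = ((0,0,1),(2,0,0),(1,-1,0))`, `C₀ = ((1,1,0),(0,0,1),(-1,1,0))`
  (found by hand from the weight system: the six cells `(0,0,1),(0,0,2),(0,2,0),(0,2,1),(0,2,2),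
  (2,2,1)` of `(A₀ ⊗ B₀ ⊗ C₀)·P` must vanish, the four cells of `T₂` sit at weight exactly `4`,
  everything else higher).  It holds over every field of characteristic `≠ 2`
  (`sThree_polyDegeneratesTo_tTwo`); the multiplier is OPTIMAL: modulo `2`, `P ≡ ε` (`perm ≡ det`)
  is alternating, every matrix of its slice pencil is singular (`det = 2μ₀μ₁μ₂`), a closed invariant
  condition inherited by degenerations (`not_polyDegeneratesTo_sThree_of_two_eq_zero`: **with
  `2 = 0`, `P` degenerates to NO tensor whose slice pencil contains an invertible matrix**), while
  the pencil of `T₂` contains the identity: `not_polyDegeneratesTo_sThree_tTwo_of_two_eq_zero` —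
  `P ⋭ T₂` over every nontrivial commutative ring with `2 = 0`, so `sThree_polyDegeneratesTo_tTwo_iff` —
  over a field, **`P ⊵ T₂ ⟺ char ≠ 2`**.
* further boundary points of the orbit of `T_{cw,2}` found by the census (the null algebra
  `ℂ[x,y]/𝔪²`, Nurmiev's orbits) are certified in the companion file `SoloInformedCwTwoBoundary.lean`.
* `cwTensor_two_polyDegeneratesTo_tTwo` — hence **`T_{cw,2} ⊵ T₂` over `ℂ`**, and
  `asymptoticRank_tTwo_le_cwTensor_two` — `R̃(T₂) ≤ R̃(T_{cw,2})`.
* `asymptoticRank_tTwo_eq_three_of_door` — **door D1 casts a shadow on `U₂`:**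
  `R̃(T_{cw,2}) ≤ 3 ⇒ R̃(T₂) = 3`, i.e. the incidence algebras `I(B_N) = U₂^{⊗N}` of the Boolean
  lattices (structure tensor `T₂^{⊠N}`, border rank `≥ 4` at `N = 1` but `≤ 14 < 16` at `N = 2`,
  gen 24) would have tensor rank `3^{N + o(N)}`.  The lower bound `3 ≤ R̃(T₂)` is the flattening
  bound (`three_le_asymptoticRank_tTwo`, dual pairs).
* `asymptoticRank_tTwo_lt_of_almanLi` — the Alman–Li bound `R̃(T_{cw,2}) < 3.931` (named fact,
  hypothesis) transfers: `R̃(T₂) < 3.931`; but the DIRECT kernel bound is better: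
  `asymptoticRank_tTwo_le_sqrt_fourteen` — **`R̃(T₂) ≤ √14 < 3.742`** over every field, from the
  gen-24 Bini certificate `R̲(T₂ ⊠ T₂) ≤ 14` (`algBorderRank_kroneckerTensor_tTwo_tTwo_le_fourteen`)
  and `R̃(t) ≤ R̲(t^{⊠N})^{1/N}`; in particular `asymptoticRank_tTwo_lt_algBorderRank` —
  **`R̃(T₂) < R̲(T₂) = 4`** unconditionally, a `3 × 3 × 3` instance of strict inequality between
  asymptotic rank and border rank decided in the kernel.

Remark (Bläser–Lysikov).  `T₂ = T_{U₂}` is the structure tensor of a unital associative algebra and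
`T_{cw,2}` is binding (`1_A`- and `1_B`-generic), hence equivalent to a unital bilinear map — but to
no ASSOCIATIVE one (the unital associative `3`-dimensional algebras are `ℂ³`, `ℂ × ℂ[t]/t²`,
`ℂ[t]/t³`, `ℂ[x,y]/(x,y)²` of border rank `3` and `U₂`, orbit dimension `19 ≠ 23`), so Theorem 6 of
Bläser–Lysikov 2016 (tensor degeneration = algebraic degeneration, for an associative unital SOURCE)
does not apply to degenerations out of `T_{cw,2}`; the certificate above is a genuinely three-factor
(`A ≠ B ≠ C`) degeneration.

## References

* [CoppersmithWinograd1990] D. Coppersmith, S. Winograd, J. Symbolic Comput. 9 (1990) — §6/§11.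
* [ConnerGesmundoLandsbergVentura2022] A. Conner, F. Gesmundo, J. M. Landsberg, E. Ventura, *Rank and
  border rank of Kronecker powers of tensors and Strassen's laser method*, comput. complexity 31
  (2022) — §3.2 (`T_{cw,2} ≅ 2∑_σ`).
* [BlaserLysikov2016] M. Bläser, V. Lysikov, *On degeneration of tensors and algebras*, MFCS 2016,
  LIPIcs 58, Art. 19 — Thm. 6, §3.4.
* [AlmanLi2026] J. Alman, B. Li, SODA 2026 — Thm. 1.3 (`R̃(T_{cw,2}) < 3.931`).
* [Alman2021] J. Alman, Theory of Computing 17 (2021), §2.4 (degeneration, `R̃` monotone).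
* [Blaser2013] M. Bläser, *Fast Matrix Multiplication*, Theory of Computing Graduate Surveys 5
  (2013), Lemma 7.1 (flattening lower bound).
-/

noncomputable section

open scoped BigOperators Polynomial

namespace Summit.MatrixMultiplication.MatrixMultiplication.Theorems

open Literature.Computability.AlgebraicComplexity
open Literature.Barriers.MatrixMultiplication (PolyDegeneratesTo asymptoticRank_le_of_polyDegeneratesTo
  flatteningRank_le_asymptoticRank)

/-! ## The tensor `P = ∑_{σ ∈ 𝔖₃} e_{σ(0)} e_{σ(1)} e_{σ(2)}` -/

/-- `P = ∑_{σ ∈ 𝔖₃} e_{σ(0)} ⊗ e_{σ(1)} ⊗ e_{σ(2)}` (entries `|ε_{ijk}|`, the polarisation of the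
monomial `x₀x₁x₂`) as an integer tensor. [cite: ConnerGesmundoLandsbergVentura2022, §3.2] -/
def sThreeInt : Fin 3 → Fin 3 → Fin 3 → ℤ :=
  ApproxCert.ofEntries 3 3 3
    [((0, 1, 2), 1), ((0, 2, 1), 1), ((1, 0, 2), 1), ((1, 2, 0), 1), ((2, 0, 1), 1), ((2, 1, 0), 1)]

/-- `P` over a commutative ring `K`. [cite: ConnerGesmundoLandsbergVentura2022, §3.2] -/
def sThree (K : Type*) [CommRing K] : Fin 3 → Fin 3 → Fin 3 → K := fun i j l => (sThreeInt i j l : K)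

/-- The entries of `P` are `|ε_{ijk}|`. [cite: ConnerGesmundoLandsbergVentura2022, §3.2] -/
theorem sThreeInt_eq_abs_leviCivita3 (i j k : Fin 3) : sThreeInt i j k = |leviCivita3 i j k| := by
  rw [leviCivita3_eq_table]
  revert i j k
  decide

/-! ## The certificate `P ⊵₄ 2·T₂` -/

/-- **Kernel certificate: `P ⊵ T₂` with order `4` and multiplier `2`.**  Coefficient lists (ascending
in `ε`, source index first): `A i i' = (A₀)_{i' i} ε^{α_{i'}}` with `α = (0,4,3)`,
`A₀ = ((1,1,0),(-2,0,0),(0,0,1))`; `B j j' = (B₀)_{j' j} ε^{β_{j'}}`, `β = (2,4,0)`,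
`B₀ = ((0,0,1),(2,0,0),(1,-1,0))`; `C l l' = (C₀)_{l' l} ε^{γ_{l'}}`, `γ = (2,0,1)`,
`C₀ = ((1,1,0),(0,0,1),(-1,1,0))`.  Then `(A ⊗ B ⊗ C)(ε)·P ≡ 2ε⁴·T₂ (mod ε⁵)` entrywise. -/
theorem sThree_tTwo_check :
    DegenCert.check 3 3 3 3 3 3 4 2 sThreeInt tTwoInt
      ![![[1], [0, 0, 0, 0, -2], []], ![[1], [], []], ![[], [], [0, 0, 0, 1]]]
      ![![[], [0, 0, 0, 0, 2], [1]], ![[], [], [-1]], ![[0, 0, 1], [], []]]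
      ![![[0, 0, 1], [], [0, -1]], ![[0, 0, 1], [], [0, 1]], ![[], [1], []]] = true := by
  decide +kernel

/-- **`P ⊵ T₂` over every field of characteristic `≠ 2`.** -/
theorem sThree_polyDegeneratesTo_tTwo (K : Type*) [Field K] (h2 : (2 : K) ≠ 0) :
    PolyDegeneratesTo (sThree K) (tTwo K) := by
  have hD : IsUnit (((2 : ℤ) : K)) := by
    rw [Int.cast_ofNat]
    exact isUnit_iff_ne_zero.mpr h2
  exact DegenCert.polyDegeneratesTo_of_check K sThree_tTwo_check hD

/-- `R̃(T₂) ≤ R̃(P)` over every field of characteristic `≠ 2`. [cite: Alman2021, §2.4] -/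
theorem asymptoticRank_tTwo_le_sThree (K : Type*) [Field K] (h2 : (2 : K) ≠ 0) :
    asymptoticRank (tTwo K) ≤ asymptoticRank (sThree K) :=
  asymptoticRank_le_of_polyDegeneratesTo (sThree_polyDegeneratesTo_tTwo K h2)


/-! ## Characteristic `2`: the multiplier `D = 2` is optimal -/

section CharTwo

open Polynomial

/-- **In characteristic `2`, `P` degenerates to no `1_A`-generic tensor.**  Modulo `2`, `P ≡ ε` and every
matrix of the slice pencil `∑_a μ_a P(a,·,·) = ((0,μ₂,μ₁),(μ₂,0,μ₀),(μ₁,μ₀,0))` is singular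
(`det = 2μ₀μ₁μ₂`); for a degeneration `(A,B,C)(ε)` of order `h` with limit `t`, the pencil matrix of the
substituted tensor at `ν` is `Q = Bᵀ·M(Aν)·C`, so `det Q = 0`, while `Q = ε^h (N + ε R)` with
`N = ∑_a ν_a t(a,·,·)`, whence `det N = 0`.  (By the `𝔖₃`-symmetry of `P` the same holds for the other
two slice directions.) -/
theorem not_polyDegeneratesTo_sThree_of_two_eq_zero (K : Type*) [CommRing K] (h2 : (2 : K) = 0)
    (t : Fin 3 → Fin 3 → Fin 3 → K) (ν : Fin 3 → K)
    (hdet : (Matrix.of fun b c => ∑ a, ν a * t a b c).det ≠ 0) :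
    ¬ PolyDegeneratesTo (sThree K) t := by
  classical
  rintro ⟨h, A, B, C, hd⟩
  let μ : Fin 3 → K[X] := fun a => ∑ i, Polynomial.C (ν i) * A a i
  let Bm : Matrix (Fin 3) (Fin 3) K[X] := Matrix.of fun b b' => B b b'
  let Cm : Matrix (Fin 3) (Fin 3) K[X] := Matrix.of fun c c' => C c c'
  let M : Matrix (Fin 3) (Fin 3) K[X] :=
    Matrix.of fun b c => ∑ a, Polynomial.C (sThree K a b c) * μ a
  let Q : Matrix (Fin 3) (Fin 3) K[X] := Bm.transpose * M * Cm
  let N : Matrix (Fin 3) (Fin 3) K := Matrix.of fun b c => ∑ a, ν a * t a b c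
  have hQ : ∀ b' c', Q b' c' =
      ∑ i, Polynomial.C (ν i) *
        ∑ a, ∑ b, ∑ c, Polynomial.C (sThree K a b c) * (A a i * B b b' * C c c') := by
    intro b' c'
    simp only [Q, Bm, Cm, M, μ, Matrix.mul_apply, Matrix.transpose_apply, Matrix.of_apply,
      Fin.sum_univ_three]
    ring
  have hM : M = !![0, μ 2, μ 1; μ 2, 0, μ 0; μ 1, μ 0, 0] := by
    ext b c
    fin_cases b <;> fin_cases c <;>
      simp [M, sThree, sThreeInt, ApproxCert.ofEntries, Fin.sum_univ_three]
  have h2X : (2 : K[X]) = 0 := by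
    rw [← map_ofNat Polynomial.C 2, h2, map_zero]
  have hdetM : M.det = 0 := by
    calc M.det = 2 * (μ 0 * μ 1 * μ 2) := by rw [hM, Matrix.det_fin_three]; simp; ring
      _ = 0 := by rw [h2X, zero_mul]
  have hdetQ : Q.det = 0 := by
    simp [Q, Matrix.det_mul, Matrix.det_transpose, hdetM]
  have hcoeff : ∀ b' c', ∀ j ≤ h, (Q b' c').coeff j = if j = h then N b' c' else 0 := by
    intro b' c' j hj
    rw [hQ, Polynomial.finsetSum_coeff]
    simp only [Polynomial.coeff_C_mul]
    by_cases hjh : j = h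
    · simp only [hjh, if_true, N, Matrix.of_apply]
      refine Finset.sum_congr rfl fun i _ => ?_
      rw [hd i b' c' h le_rfl, if_pos rfl]
    · simp only [hjh, if_false]
      refine Finset.sum_eq_zero fun i _ => ?_
      rw [hd i b' c' j hj, if_neg hjh, mul_zero]
  have hdvd : ∀ b' c', X ^ (h + 1) ∣ Q b' c' - Polynomial.C (N b' c') * X ^ h := by
    intro b' c'
    rw [Polynomial.X_pow_dvd_iff]
    intro d hd'
    rw [Polynomial.coeff_sub, Polynomial.coeff_C_mul, Polynomial.coeff_X_pow, hcoeff b' c' d (by omega)]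
    split_ifs <;> simp_all
  choose R hR using hdvd
  have hQeq : Q = ((X : K[X]) ^ h) • (N.map Polynomial.C + (X : K[X]) • Matrix.of R) := by
    refine Matrix.ext fun b' c' => ?_
    have := hR b' c'
    rw [sub_eq_iff_eq_add] at this
    rw [this]
    simp only [Matrix.smul_apply, Matrix.add_apply, Matrix.map_apply, Matrix.of_apply, smul_eq_mul]
    ring
  have hconst : Polynomial.constantCoeff
      ((N.map Polynomial.C + (X : K[X]) • Matrix.of R).det) = N.det := by
    rw [RingHom.map_det]
    have : (Polynomial.constantCoeff : K[X] →+* K).mapMatrix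
        (N.map Polynomial.C + (X : K[X]) • Matrix.of R) = N := by
      refine Matrix.ext fun i j => ?_
      simp
    rw [this]
  have hzero : (N.map Polynomial.C + (X : K[X]) • Matrix.of R).det = 0 := by
    have h1 := hdetQ
    rw [hQeq, Matrix.det_smul, Fintype.card_fin, ← pow_mul] at h1
    exact (Polynomial.monic_X_pow _).mul_right_eq_zero_iff.mp h1
  rw [hzero, map_zero] at hconst
  exact hdet hconst.symm

/-- **In characteristic `2`, `P ⋭ T₂`**: the pencil of `T₂` at `ν = (1,0,1)` is the identity. -/
theorem not_polyDegeneratesTo_sThree_tTwo_of_two_eq_zero (K : Type*) [CommRing K] [Nontrivial K]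
    (h2 : (2 : K) = 0) : ¬ PolyDegeneratesTo (sThree K) (tTwo K) := by
  refine not_polyDegeneratesTo_sThree_of_two_eq_zero K h2 (tTwo K) ![1, 0, 1] ?_
  have : (Matrix.of fun b c => ∑ a, (![1, 0, 1] : Fin 3 → K) a * tTwo K a b c) = 1 := by
    ext b c
    fin_cases b <;> fin_cases c <;>
      simp [tTwo, tTwoInt, ApproxCert.ofEntries, Fin.sum_univ_three]
  rw [this, Matrix.det_one]
  exact one_ne_zero

/-- **`P ⊵ T₂` over a field `K` iff `char K ≠ 2`.** -/
theorem sThree_polyDegeneratesTo_tTwo_iff (K : Type*) [Field K] :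
    PolyDegeneratesTo (sThree K) (tTwo K) ↔ (2 : K) ≠ 0 :=
  ⟨fun h h2 => not_polyDegeneratesTo_sThree_tTwo_of_two_eq_zero K h2 h,
    sThree_polyDegeneratesTo_tTwo K⟩

end CharTwo

/-! ## Over `ℂ`: `T_{cw,2} ⊵ T₂` -/

/-- `T_{cw,2}` restricts to (indeed is isomorphic to) `P` over `ℂ`: CGLV's basis `A` with
`(A,A,A)·T_{cw,2} = 2P`, first factor rescaled by `1/2`.
[cite: ConnerGesmundoLandsbergVentura2022, §3.2 (proof of Lemma 2.4)] -/
theorem cwTensor_two_restrictsTo_sThree : TensorRestrictsTo (cwTensor ℂ 2) (sThree ℂ) := by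
  obtain ⟨A, -, hA⟩ := cglv_exists_basis_cwTensor_two
  refine ⟨fun i i' => (1 / 2 : ℂ) * A i i', A, A, fun i j k => ?_⟩
  have h2 : (∑ i', ∑ j', ∑ k', (1 / 2 : ℂ) * A i i' * A j j' * A k k' * cwTensor ℂ 2 i' j' k') =
      (1 / 2 : ℂ) * ∑ i', ∑ j', ∑ k', A i i' * A j j' * A k k' * cwTensor ℂ 2 i' j' k' := by
    simp_rw [Finset.mul_sum]
    refine Finset.sum_congr rfl fun _ _ => Finset.sum_congr rfl fun _ _ =>
      Finset.sum_congr rfl fun _ _ => by ring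
  rw [h2, hA i j k, sThree, sThreeInt_eq_abs_leviCivita3]
  ring

/-- **`T_{cw,2} ⊵ T₂` over `ℂ`** (restriction to `P`, then the certified degeneration). -/
theorem cwTensor_two_polyDegeneratesTo_tTwo : PolyDegeneratesTo (cwTensor ℂ 2) (tTwo ℂ) :=
  cwTensor_two_restrictsTo_sThree.trans_polyDegeneratesTo
    (sThree_polyDegeneratesTo_tTwo ℂ two_ne_zero)

/-- **`R̃(T₂) ≤ R̃(T_{cw,2})`.** [cite: Alman2021, §2.4] -/
theorem asymptoticRank_tTwo_le_cwTensor_two :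
    asymptoticRank (tTwo ℂ) ≤ asymptoticRank (cwTensor ℂ 2) :=
  asymptoticRank_le_of_polyDegeneratesTo cwTensor_two_polyDegeneratesTo_tTwo

/-! ## The flattening lower bound `3 ≤ R̃(T₂)` -/

/-- Dual pairs give the flattening lower bound `|ι| = ζ⁽¹⁾(t) ≤ R̃(t)` (the `x`-slices are linearly
independent). [cite: Blaser2013, Lemma 7.1 (2) (proof)] -/
private theorem card_le_asymptoticRank_of_dualPairs' {ι κ μ : Type} [Fintype ι] [Fintype κ]
    [Fintype μ] [DecidableEq ι] (t : ι → κ → μ → ℂ) (P : ι → κ) (Q : ι → μ)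
    (h : ∀ o o', t o' (P o) (Q o) = if o' = o then 1 else 0) :
    (Fintype.card ι : ℝ) ≤ asymptoticRank t := by
  have hli : LinearIndependent ℂ (xSlices t) := by
    rw [Fintype.linearIndependent_iff]
    intro g hg o
    have key := congrFun hg (P o, Q o)
    rw [Finset.sum_apply, Pi.zero_apply] at key
    simp only [Pi.smul_apply, xSlices_apply, smul_eq_mul, h] at key
    simpa using key
  have hfr : flatteningRank t = Fintype.card ι := by
    unfold flatteningRank
    exact finrank_span_eq_card hli
  have hle := flatteningRank_le_asymptoticRank t
  rw [hfr] at hle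
  exact hle

/-- **`3 ≤ R̃(T₂)`**: the dual pairs `(0;0,0)`, `(1;2,1)`, `(2;2,2)` make the three `x`-slices of `T₂`
linearly independent. [cite: Blaser2013, Lemma 7.1 (2)] -/
theorem three_le_asymptoticRank_tTwo : (3 : ℝ) ≤ asymptoticRank (tTwo ℂ) := by
  have h3 : (3 : ℝ) = (Fintype.card (Fin 3) : ℝ) := by norm_num
  rw [h3]
  refine card_le_asymptoticRank_of_dualPairs' (tTwo ℂ) ![0, 2, 2] ![0, 1, 2] ?_
  intro o o'
  fin_cases o <;> fin_cases o' <;> simp [tTwo, tTwoInt, ApproxCert.ofEntries]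

/-! ## The shadow of door D1 on `U₂` -/

/-- **Door D1 casts a shadow on `U₂`: `R̃(T_{cw,2}) ≤ 3 ⇒ R̃(T₂) = 3`** (whereas `R̲(T₂) = 4`). -/
theorem asymptoticRank_tTwo_eq_three_of_door (h : asymptoticRank (cwTensor ℂ 2) ≤ 3) :
    asymptoticRank (tTwo ℂ) = 3 :=
  le_antisymm (asymptoticRank_tTwo_le_cwTensor_two.trans h) three_le_asymptoticRank_tTwo

/-- The same with the door hypothesis as an equality. -/
theorem asymptoticRank_tTwo_eq_three_of_door' (h : asymptoticRank (cwTensor ℂ 2) = 3) :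
    asymptoticRank (tTwo ℂ) = 3 :=
  asymptoticRank_tTwo_eq_three_of_door h.le

/-- **Alman–Li transfer: `R̃(T₂) < 3.931`** from the named fact `R̃(T_{cw,2}) < 3.931`.
[cite: AlmanLi2026, Thm 1.3] -/
theorem asymptoticRank_tTwo_lt_of_almanLi (h : AlmanLi2026_asymptoticRank_cwTwo_lt) :
    asymptoticRank (tTwo ℂ) < 3.931 :=
  lt_of_le_of_lt asymptoticRank_tTwo_le_cwTensor_two h

/-! ## Unconditionally: `R̃(T₂) ≤ √14 < R̲(T₂) = 4` -/

/-- `R̲(T₂^{⊠2}) ≤ 14` (the gen-24 Bini certificate, transported from `T₂ ⊠ T₂` to the Kronecker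
power `T₂^{⊠2}`). -/
theorem algBorderRank_kroneckerPow_two_tTwo_le (K : Type*) [Field K] :
    algBorderRank (kroneckerPow (tTwo K) 2) ≤ 14 := by
  rw [algBorderRank_kroneckerPow_succ]
  have h : kroneckerTensor (tTwo K) (kroneckerPow (tTwo K) 1) = fun a b c =>
      kroneckerTensor (tTwo K) (tTwo K)
        ((Equiv.prodCongr (Equiv.refl (Fin 3)) (Equiv.funUnique (Fin 1) (Fin 3))) a)
        ((Equiv.prodCongr (Equiv.refl (Fin 3)) (Equiv.funUnique (Fin 1) (Fin 3))) b)
        ((Equiv.prodCongr (Equiv.refl (Fin 3)) (Equiv.funUnique (Fin 1) (Fin 3))) c) := by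
    funext a b c
    simp [kroneckerTensor]
  rw [h, algBorderRank_reindex]
  exact algBorderRank_kroneckerTensor_tTwo_tTwo_le_fourteen K


/-- **Level-2 separation from the door tensor** (with CGLV Thm. 1.2 as hypothesis):
`R̲(T₂^{⊠2}) ≤ 14 < 15 ≤ R̲(T_{cw,2}^{⊠2})`, although `R̲(T₂) = R̲(T_{cw,2}) = 4` — the shadow is
strictly cheaper than the door tensor at the Kronecker square.
[cite: ConnerGesmundoLandsbergVentura2022, Thm. 1.2] -/
theorem algBorderRank_kroneckerPow_two_tTwo_lt_cwTensor (h : CGLV2022_thm12_square) :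
    algBorderRank (kroneckerPow (tTwo ℂ) 2) < algBorderRank (kroneckerPow (cwTensor ℂ 2) 2) :=
  lt_of_le_of_lt (algBorderRank_kroneckerPow_two_tTwo_le ℂ) (lt_of_lt_of_le (by norm_num) h.2.1)

/-- **`R̃(T₂) ≤ 14^{1/2}`** over every field. -/
theorem asymptoticRank_tTwo_le_rpow (K : Type*) [Field K] :
    asymptoticRank (tTwo K) ≤ (14 : ℝ) ^ ((2 : ℝ)⁻¹) := by
  have := asymptoticRank_le_rpow_of_algBorderRank_kroneckerPow_le (t := tTwo K) (N := 2) (r := 14)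
    (by norm_num) (algBorderRank_kroneckerPow_two_tTwo_le K)
  exact_mod_cast this

/-- **`R̃(T₂) ≤ √14`** (`< 3.742`) over every field. -/
theorem asymptoticRank_tTwo_le_sqrt_fourteen (K : Type*) [Field K] :
    asymptoticRank (tTwo K) ≤ Real.sqrt 14 := by
  rw [Real.sqrt_eq_rpow, show (1 / 2 : ℝ) = (2 : ℝ)⁻¹ by norm_num]
  exact asymptoticRank_tTwo_le_rpow K

/-- `√14 < 4`. -/
private theorem sqrt_fourteen_lt_four : Real.sqrt 14 < 4 := by
  rw [show (4 : ℝ) = Real.sqrt 16 by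
    rw [show (16 : ℝ) = 4 ^ 2 by norm_num, Real.sqrt_sq (by norm_num)]]
  exact Real.sqrt_lt_sqrt (by norm_num) (by norm_num)

/-- **`R̃(T₂) < 4 = R̲(T₂)`** over every field: asymptotic rank strictly below border rank for a
`3 × 3 × 3` tensor, decided in the kernel. -/
theorem asymptoticRank_tTwo_lt_algBorderRank (K : Type*) [Field K] :
    asymptoticRank (tTwo K) < (algBorderRank (tTwo K) : ℝ) := by
  rw [algBorderRank_tTwo K]
  push_cast
  exact (asymptoticRank_tTwo_le_sqrt_fourteen K).trans_lt sqrt_fourteen_lt_four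

/-- Summary over `ℂ`: `3 ≤ R̃(T₂) ≤ min(R̃(T_{cw,2}), √14) < 4 = R̲(T₂)`. -/
theorem tTwo_shadow_summary :
    (3 : ℝ) ≤ asymptoticRank (tTwo ℂ) ∧ asymptoticRank (tTwo ℂ) ≤ asymptoticRank (cwTensor ℂ 2) ∧
      asymptoticRank (tTwo ℂ) ≤ Real.sqrt 14 ∧ Real.sqrt 14 < (algBorderRank (tTwo ℂ) : ℝ) ∧
      algBorderRank (tTwo ℂ) = 4 :=
  ⟨three_le_asymptoticRank_tTwo, asymptoticRank_tTwo_le_cwTensor_two,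
    asymptoticRank_tTwo_le_sqrt_fourteen ℂ,
    by rw [algBorderRank_tTwo ℂ]; push_cast; exact sqrt_fourteen_lt_four, algBorderRank_tTwo ℂ⟩

end Summit.MatrixMultiplication.MatrixMultiplication.Theorems

end
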